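import Summits.BirchSwinnertonDyer.BirchSwinnertonDyer.Theorems.ByReductionTypeAtTwoSupersingularFlatZetaF3Assembly
import Literature.NumberTheory.EllipticCurves.Kato2004.DivisibilityInputsZetaLine
import Literature.NumberTheory.EllipticCurves.IwasawaAlgebraProofs
import HarnessLib

/-!
# Crux `SupersingularRankZeroAtTwo` (K4, item stmt-BirchSwinnertonDyer-19097), line `odd_blind_package` v2.20, `stub_flatPackage`
# conjunct (8), F3b — FILE B1 of hand «(B1)♭-DECIDE»: THE ♭ RECIPROCITY CONSTANT — the two displayed `2`-adic conditions of the F3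
# assembly (`h2`: «some cusp multiplier `A_δ` is prime to `(2)`», (B1)♭: «`t = ϖ·d ∈ ℤ₂`») IN INVARIANT FORM

Seat `bsd-2adic-tower-1` GEN 70 (pen GEN 41 SUMMON 20260831T234826Z, LEAD ss-1 GEN 26 notes (N1)–(N3)). HONEST FRAMING: theorems only
(no definition, no named fact, no instance, no `sorry`); helper toward the displayed residue of conjunct (8) F3b of `stub_flatPackage`;
closes no stub and no item; 19097 OPEN; BSD₂ is proved for no supersingular curve and BSD for no curve by any of this.

## What

The assembly Z6 (`SSFlatPackage.flatF3_package_of_levelCongruences`, t42 GEN 51) consumes a family of classes `x_δ ∈ 𝐇¹` with multipliers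
`A_δ ∈ Λ = ℤ₂⟦T⟧`, one constant `d ∈ ℤ₂ ∖ 0`, the levelwise congruences `hE3` (tower-1 E3/E5: `A_δ := C(N·q.num)·μ̃_δ`, `d := D·q.den`),
and two `2`-adic side conditions: `h2` (every height-one prime `𝔭 ∋ 2` misses some `A_δ`) and `(t : ℤ_[2]) (ht : ↑t = ϖ·d)`.  Neither
`q` (Kato's constant of the DISPLAYED `ZetaBody` family — the print shape is closed under `(κ, z, x) ↦ (2κ, 2z, 2x)`) nor `D` (any
denominator-clearing integer of the cusp brick) is an invariant of the curve.  This file proves that both conditions have an invariant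
meaning in which `q`, `D`, `N`, `q.num`, `q.den` do not occur:

* §1 (Λ-algebra): `h2` ⟺ «`∃ δ, A_δ ∉ (2)`» (`forall_heightOne_C_two_mem_iff`, by the tree's `eq_augIdealP_of_height_eq_one_of_C_mem`);
  `C k·μ ∉ (2) ⟺ 2 ∤ k ∧ μ ∉ (2)`; `C d·σ = L`, `L ∉ (2)` ⇒ `d ∈ ℤ₂ˣ`; and `(∃ t : ℤ_[2], ↑t = ϖ·d) ⟺ 0 ≤ v₂(ϖ)` for a unit `d`
  (`exists_padicInt_coe_eq_mul_iff_of_isUnit`), resp. `⟸` for any `d` (`exists_padicInt_coe_eq_mul_of_padicValRat_nonneg`).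
* §2 (Z6's frame, `p`-generic): ★ THE ♭ EXPLICIT RECIPROCITY LAW OF THE FAMILY `C d · Col♭(L x_δ) = A_δ · L♭` (and `♯`) for EVERY `δ`
  (`C_mul_coleman_eq_mul_of_family`: Z6 steps 1–3 + `IsSprungPair.unique`); hence, when the analytic `μ`-invariant of `L♭` vanishes
  (`hLμ : Lf ∉ (p)`): ★ `h2` forces `d ∈ ℤ_pˣ` (`isUnit_of_family`) and ★ `A_δ ∉ (p) ⟺ Col♭(L x_δ) ∉ (p)` (`coleman_flat_not_mem_iff_of_family`) —
  so `h2` IS «some class of the family has ♭-Coleman image not divisible by `p`» (♭-PRIMITIVITY of the zeta line at `(p)`).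
* The habitat reading (`p = 2`, Z6's literal binders: Z6 with `(t, ht)` replaced by `0 ≤ padicValRat 2 ϖ`; `d ∈ ℤ₂ˣ`; `v₂(t) = v₂(ϖ)`;
  `h2` ⟺ ♭-primitivity) is the companion file `…FlatReciprocityConstantHabitat.lean`.  So (B1)♭ DECIDED relative to `h2`: it is exactly
  «`v₂(ϖ) ≥ 0`», i.e. on the habitat (odd isogeny degrees) «the Manin constant of the optimal curve is odd» — numbers in the seat's
  census memo, not here.

References: [Kato2004Asterisque] Thm. 12.5 (1)(4), Thm. 12.6, §13.9, §13.12–13.14 (pp. 221–234); [Sprung2017] Thm. 1.12 (uniqueness), Cor. 4.4–4.5;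
[Sprung2012] Def. 7.1, Thm. 7.14; [Washington1997] §13.1–13.2.
-/

set_option autoImplicit false
-- the Theorems namespace of this sub repeats the summit name by design (D-0017 nested layout)
set_option linter.dupNamespace false

noncomputable section

open scoped Classical NumberField

open Polynomial

namespace Summit.BirchSwinnertonDyer.BirchSwinnertonDyer.Theorems

namespace SSFlatERL

open NumberField IsDedekindDomain WeierstrassCurve Literature.NumberTheory.EllipticCurves
  Literature.NumberTheory.EllipticCurves.ZpExtension Literature.NumberTheory.EllipticCurves.Sprung2017
  Literature.NumberTheory.EllipticCurves.Kobayashi2003 Literature.NumberTheory.EllipticCurves.Sprung2012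
  Literature.NumberTheory.EllipticCurves.Rank1Residual Literature.NumberTheory.GaloisRepresentations CongruenceSubgroup
  SSFlatPackage
open Literature.NumberTheory.EllipticCurves.IwasawaAlgebra

/-! ## §1 The `Λ`- and `ℤ₂`-algebra of the two displayed conditions -/

section Algebra

variable {p : ℕ} [hp : Fact p.Prime]

/-- `(p) ⊂ ℤ_p⟦T⟧` in the token of the F3 assembly: `Ideal.span {C (p : ℤ_[p])} = augIdealP p`. [cite: Washington1997, §13.2] -/
theorem span_C_eq_augIdealP : Ideal.span {PowerSeries.C (p : ℤ_[p])} = augIdealP p := rfl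

/-- **`h2` ⟺ «some multiplier is prime to `(p)`».**  The clause «every height-one prime `𝔭 ∋ C p` misses some `A_δ`» of the F3 assembly
is equivalent to «`∃ δ, A_δ ∉ (p)`»: the only height-one prime of `ℤ_p⟦T⟧` containing `p` is `(p)` (tree:
`Kato2004.eq_augIdealP_of_height_eq_one_of_C_mem`), and `(p)` is a height-one prime (`isPrime_augIdealP_holds`, `height_augIdealP_holds`).
[cite: Washington1997, §13.2] -/
theorem forall_heightOne_C_mem_iff {ι : Type*} (A : ι → IwasawaAlgebra p) :
    (∀ 𝔭 : PrimeSpectrum (IwasawaAlgebra p), 𝔭.asIdeal.height = 1 →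
      PowerSeries.C (p : ℤ_[p]) ∈ 𝔭.asIdeal → ∃ i, A i ∉ 𝔭.asIdeal) ↔
    ∃ i, A i ∉ augIdealP p := by
  constructor
  · intro h
    haveI : (augIdealP p).IsPrime := isPrime_augIdealP_holds p
    exact h ⟨augIdealP p, this⟩ (height_augIdealP_holds p) (Ideal.mem_span_singleton_self _)
  · rintro ⟨i, hi⟩ 𝔭 h𝔭 hmem
    rw [Kato2004.eq_augIdealP_of_height_eq_one_of_C_mem 𝔭 h𝔭 hmem]
    exact ⟨i, hi⟩

/-- The `p = 2` reading of `forall_heightOne_C_mem_iff` in the literal token `C (2 : ℤ_[2])` of Z6's `h2`. [cite: Washington1997, §13.2] -/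
theorem forall_heightOne_C_two_mem_iff {ι : Type*} (A : ι → IwasawaAlgebra 2) :
    (∀ 𝔭 : PrimeSpectrum (IwasawaAlgebra 2), 𝔭.asIdeal.height = 1 →
      PowerSeries.C (2 : ℤ_[2]) ∈ 𝔭.asIdeal → ∃ i, A i ∉ 𝔭.asIdeal) ↔
    ∃ i, A i ∉ augIdealP 2 := by
  rw [← forall_heightOne_C_mem_iff A]
  simp only [Nat.cast_ofNat]

/-- `C (k : ℤ_[p]) ∈ (p) ⟺ p ∣ k` for an integer `k`. [cite: Washington1997, §13.1] -/
theorem C_intCast_mem_augIdealP_iff (k : ℤ) :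
    PowerSeries.C (k : ℤ_[p]) ∈ augIdealP p ↔ (p : ℤ) ∣ k := by
  rw [mem_augIdealP_iff]
  constructor
  · intro h
    have h0 := h 0
    rw [PowerSeries.coeff_zero_C] at h0
    exact (PadicInt.norm_int_lt_one_iff_dvd k).mp (PadicInt.norm_lt_one_iff_dvd _ |>.mpr h0)
  · intro h n
    have hk : (p : ℤ_[p]) ∣ (k : ℤ_[p]) := (PadicInt.norm_lt_one_iff_dvd _).mp ((PadicInt.norm_int_lt_one_iff_dvd k).mpr h)
    rcases Nat.eq_zero_or_pos n with rfl | hn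
    · rwa [PowerSeries.coeff_zero_C]
    · rw [PowerSeries.coeff_C, if_neg hn.ne']
      exact dvd_zero _

/-- **`C k · μ ∉ (p) ⟺ p ∤ k ∧ μ ∉ (p)`** (`(p)` is prime): the reading of `A_δ = C(N·q.num)·μ̃_δ ∉ (2)` as «`2 ∤ N·q.num` and
`μ̃_δ ∉ 2Λ`». [cite: Washington1997, §13.1] -/
theorem C_intCast_mul_not_mem_augIdealP_iff (k : ℤ) (μ : IwasawaAlgebra p) :
    PowerSeries.C (k : ℤ_[p]) * μ ∉ augIdealP p ↔ ¬ (p : ℤ) ∣ k ∧ μ ∉ augIdealP p := by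
  rw [(isPrime_augIdealP_holds p).mul_mem_iff_mem_or_mem, not_or, C_intCast_mem_augIdealP_iff]

/-- **`C d · σ = L` with `L ∉ (p)` forces `d ∈ ℤ_pˣ`**: otherwise `p ∣ d` and `L = C p · (C (d/p) · σ) ∈ (p)`.
[cite: Washington1997, §13.1] -/
theorem isUnit_of_C_mul_eq_of_not_mem_augIdealP {d : ℤ_[p]} {σ L : IwasawaAlgebra p}
    (h : PowerSeries.C d * σ = L) (hL : L ∉ augIdealP p) : IsUnit d := by
  by_contra hd
  apply hL
  have hlt : ‖d‖ < 1 := lt_of_le_of_ne d.norm_le_one (fun h1 ↦ hd (PadicInt.isUnit_iff.mpr h1))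
  obtain ⟨e, rfl⟩ := (PadicInt.norm_lt_one_iff_dvd d).mp hlt
  rw [← h, augIdealP, Ideal.mem_span_singleton]
  exact ⟨PowerSeries.C e * σ, by rw [map_mul, mul_assoc]⟩

/-- In a product `C d · σ = L` with `L ∉ (p)` the factor `σ` is not in `(p)` either. [cite: Washington1997, §13.1] -/
theorem not_mem_augIdealP_of_C_mul_eq {d : ℤ_[p]} {σ L : IwasawaAlgebra p}
    (h : PowerSeries.C d * σ = L) (hL : L ∉ augIdealP p) : σ ∉ augIdealP p :=
  fun hσ ↦ hL (h ▸ Ideal.mul_mem_left _ _ hσ)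

/-- **A rational is the image of a `p`-adic integer iff its `p`-adic valuation is `≥ 0`.** [folklore] -/
theorem exists_padicInt_coe_eq_iff_padicValRat_nonneg (x : ℚ) :
    (∃ t : ℤ_[p], (t : ℚ_[p]) = (x : ℚ_[p])) ↔ 0 ≤ padicValRat p x := by
  rw [← Padic.valuation_ratCast, ← Padic.norm_le_one_iff_val_nonneg]
  constructor
  · rintro ⟨t, ht⟩
    rw [← ht]
    exact t.2
  · intro h
    exact ⟨⟨_, h⟩, rfl⟩

/-- **Sufficiency of «`v_p(ϖ) ≥ 0`» for the displayed `(t, ht)` of the F3 assembly, for ANY `d ∈ ℤ_p`**: `t := ϖ·d`. [folklore] -/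
theorem exists_padicInt_coe_eq_mul_of_padicValRat_nonneg (d : ℤ_[p]) {x : ℚ} (h : 0 ≤ padicValRat p x) :
    ∃ t : ℤ_[p], (t : ℚ_[p]) = (x : ℚ_[p]) * (d : ℚ_[p]) := by
  obtain ⟨t₀, ht₀⟩ := (exists_padicInt_coe_eq_iff_padicValRat_nonneg x).2 h
  exact ⟨t₀ * d, by rw [PadicInt.coe_mul, ht₀]⟩

/-- **For a UNIT `d`, «`∃ t : ℤ_p, t = ϖ·d`» ⟺ «`v_p(ϖ) ≥ 0`».** [folklore] -/
theorem exists_padicInt_coe_eq_mul_iff_of_isUnit {d : ℤ_[p]} (hd : IsUnit d) (x : ℚ) :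
    (∃ t : ℤ_[p], (t : ℚ_[p]) = (x : ℚ_[p]) * (d : ℚ_[p])) ↔ 0 ≤ padicValRat p x := by
  refine ⟨fun ⟨t, ht⟩ ↦ ?_, exists_padicInt_coe_eq_mul_of_padicValRat_nonneg d⟩
  obtain ⟨u, rfl⟩ := hd
  refine (exists_padicInt_coe_eq_iff_padicValRat_nonneg x).1 ⟨t * ↑u⁻¹, ?_⟩
  rw [PadicInt.coe_mul, ht, mul_assoc, ← PadicInt.coe_mul, Units.mul_inv, PadicInt.coe_one, mul_one]

/-- **For a UNIT `d` and `t = ϖ·d`: `v_p(t) = v_p(ϖ)`.** [folklore] -/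
theorem valuation_eq_padicValRat_of_isUnit {d : ℤ_[p]} (hd : IsUnit d) {x : ℚ} {t : ℤ_[p]}
    (ht : (t : ℚ_[p]) = (x : ℚ_[p]) * (d : ℚ_[p])) : (t : ℚ_[p]).valuation = padicValRat p x := by
  rw [← Padic.valuation_ratCast (p := p) x]
  have hd1 : ‖(d : ℚ_[p])‖ = 1 := by rw [PadicInt.padic_norm_e_of_padicInt]; exact PadicInt.isUnit_iff.mp hd
  have hd0 : (d : ℚ_[p]) ≠ 0 := fun h0 ↦ by rw [h0, norm_zero] at hd1; exact zero_ne_one hd1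
  by_cases hx : (x : ℚ_[p]) = 0
  · rw [ht, hx, zero_mul]
  · have hdval : (d : ℚ_[p]).valuation = 0 := by
      have h := Padic.norm_eq_zpow_neg_valuation hd0
      rw [hd1] at h
      have hp1 : (1 : ℝ) < p := by exact_mod_cast hp.out.one_lt
      have := zpow_right_injective₀ (zero_lt_one.trans hp1) hp1.ne' (h.symm.trans (zpow_zero _).symm)
      omega
    rw [ht, Padic.valuation_mul hx hd0, hdval, add_zero]

end Algebra

/-! ## §2 The ♭ explicit reciprocity law of the family and the two conditions in Z6's frame (`p`-generic) -/

section Family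

universe u

variable {K : Type u} [Field K] {p : ℕ} [hp : Fact p.Prime] {κ : ZpExtension K p}
variable {E : Type u} [Field E] [Algebra K E] {ι' : AlgebraicClosure K →ₐ[K] AlgebraicClosure E}
variable {W : WeierstrassCurve K}

/-- ★ **THE ♭ (and ♯) EXPLICIT RECIPROCITY LAW OF THE FAMILY.**  In the frame of Z6 §1 (`exists_smul_eq_coleman_and_isSprungPair_of_family`:
`Λ`-linear `L`, Coleman map `J` with `hJ`, classes `x_δ` with multipliers `A_δ` coprime at every height-one prime, `d ≠ 0`, the levelwise
congruences `hE3`) and given a Sprung pair `(L♯, L♭)` of `f`: **`C d · (J (L x_δ)).2 = A_δ · L♭` and `C d · (J (L x_δ)).1 = A_δ · L♯`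
for EVERY `δ`** — the generator `σ₀` of steps 1–2 has `A_δ • σ₀ = J (L x_δ)` and `C d·σ₀ = (L♯, L♭)` by `IsSprungPair.unique`.
[cite: Kato2004Asterisque, Thm. 12.5 (1) (p. 222), §13.9 (p. 230)] [cite: Sprung2017, Thm. 1.12, Cor. 4.4–4.5] -/
theorem C_mul_coleman_eq_mul_of_family {g : Field.absoluteGaloisGroup E}
    (hg : κ.IsTopGenerator (resGalOfEmb ι' g)) {ap : ℤ} (hap : (p : ℤ) ∣ ap) {c : ℕ → localPoints W E}
    {H : Type*} [AddCommGroup H] [Module (IwasawaAlgebra p) H]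
    (L : letI := moduleOfGenerator κ ι' W hg; H →ₗ[IwasawaAlgebra p] (localTowerPointsOfEmb κ ι' W →+ ℤ_[p]))
    (J : letI := moduleOfGenerator κ ι' W hg
      (localTowerPointsOfEmb κ ι' W →+ ℤ_[p]) →ₗ[IwasawaAlgebra p] IwasawaAlgebra p × IwasawaAlgebra p)
    (hJ : ∀ w, IsColemanPair κ ι' W ap g c w (J w).1 (J w).2)
    {ι : Type*} (x : ι → H) (A : ι → IwasawaAlgebra p) {d : ℤ_[p]} (hd : d ≠ 0)
    (hcop : ∀ 𝔭 : PrimeSpectrum (IwasawaAlgebra p), 𝔭.asIdeal.height = 1 →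
      PowerSeries.C (p : ℤ_[p]) ∉ 𝔭.asIdeal → ∃ i, A i ∉ 𝔭.asIdeal)
    (hcop2 : ∀ 𝔭 : PrimeSpectrum (IwasawaAlgebra p), 𝔭.asIdeal.height = 1 →
      PowerSeries.C (p : ℤ_[p]) ∈ 𝔭.asIdeal → ∃ i, A i ∉ 𝔭.asIdeal)
    {N : ℕ} (f : CuspForm (Gamma0 N) 2)
    (hE3 : ∀ (i : ι) (n : ℕ), ∃ (m : ℕ) (q : IwasawaAlgebra p), PowerSeries.C ((p : ℚ_[p]) ^ m) *
        (iwasawaToPowerSeries p (A i) * (((mazurTateElement f p n).map (algebraMap ℚ ℚ_[p]) : ℚ_[p][X]) : PowerSeries ℚ_[p]) -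
          iwasawaToPowerSeries p (PowerSeries.C d * pairingSum W (localTowerPointsOfEmb κ ι' W) g n (c n) (L (x i)))) =
      iwasawaToPowerSeries p ((((cyclotomicOmega p n).map (Int.castRingHom ℤ_[p]) : ℤ_[p][X]) : PowerSeries ℤ_[p]) * q))
    {Ls Lf : IwasawaAlgebra p} (hL : IsSprungPair f p ap Ls Lf) (i : ι) :
    PowerSeries.C d * (J (L (x i))).2 = A i * Lf ∧ PowerSeries.C d * (J (L (x i))).1 = A i * Ls := by
  letI := moduleOfGenerator κ ι' W hg
  obtain ⟨σ₀, hσ₀, hSP⟩ := exists_smul_eq_coleman_and_isSprungPair_of_family hg hap L J hJ x A hd hcop hcop2 f hE3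
  obtain ⟨hs, hf⟩ := IsSprungPair.unique (f := f) hap hSP hL
  rw [← hσ₀ i, Prod.smul_snd, Prod.smul_fst, smul_eq_mul, smul_eq_mul, ← hf, ← hs]
  constructor <;> ring

/-- ★ **`h2` FORCES `d ∈ ℤ_pˣ` when `μ(L♭) = 0`.**  In the frame of `C_mul_coleman_eq_mul_of_family`, if the ♭ function of the Sprung
pair is not divisible by `p` (`hLμ : Lf ∉ (p)`, the analytic `μ`-invariant vanishes) then `d` is a unit: pick `δ` with `A_δ ∉ (p)`
(`h2` via `forall_heightOne_C_mem_iff`); `C d · Col♭(L x_δ) = A_δ · L♭ ∉ (p)` since `(p)` is prime; so `C d ∉ (p)`.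
[cite: Kato2004Asterisque, Thm. 12.5 (4) (p. 222), §13.14 (p. 234)] [cite: Washington1997, §13.2] -/
theorem isUnit_of_family {g : Field.absoluteGaloisGroup E}
    (hg : κ.IsTopGenerator (resGalOfEmb ι' g)) {ap : ℤ} (hap : (p : ℤ) ∣ ap) {c : ℕ → localPoints W E}
    {H : Type*} [AddCommGroup H] [Module (IwasawaAlgebra p) H]
    (L : letI := moduleOfGenerator κ ι' W hg; H →ₗ[IwasawaAlgebra p] (localTowerPointsOfEmb κ ι' W →+ ℤ_[p]))
    (J : letI := moduleOfGenerator κ ι' W hg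
      (localTowerPointsOfEmb κ ι' W →+ ℤ_[p]) →ₗ[IwasawaAlgebra p] IwasawaAlgebra p × IwasawaAlgebra p)
    (hJ : ∀ w, IsColemanPair κ ι' W ap g c w (J w).1 (J w).2)
    {ι : Type*} (x : ι → H) (A : ι → IwasawaAlgebra p) {d : ℤ_[p]} (hd : d ≠ 0)
    (hcop : ∀ 𝔭 : PrimeSpectrum (IwasawaAlgebra p), 𝔭.asIdeal.height = 1 →
      PowerSeries.C (p : ℤ_[p]) ∉ 𝔭.asIdeal → ∃ i, A i ∉ 𝔭.asIdeal)
    (hcop2 : ∀ 𝔭 : PrimeSpectrum (IwasawaAlgebra p), 𝔭.asIdeal.height = 1 →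
      PowerSeries.C (p : ℤ_[p]) ∈ 𝔭.asIdeal → ∃ i, A i ∉ 𝔭.asIdeal)
    {N : ℕ} (f : CuspForm (Gamma0 N) 2)
    (hE3 : ∀ (i : ι) (n : ℕ), ∃ (m : ℕ) (q : IwasawaAlgebra p), PowerSeries.C ((p : ℚ_[p]) ^ m) *
        (iwasawaToPowerSeries p (A i) * (((mazurTateElement f p n).map (algebraMap ℚ ℚ_[p]) : ℚ_[p][X]) : PowerSeries ℚ_[p]) -
          iwasawaToPowerSeries p (PowerSeries.C d * pairingSum W (localTowerPointsOfEmb κ ι' W) g n (c n) (L (x i)))) =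
      iwasawaToPowerSeries p ((((cyclotomicOmega p n).map (Int.castRingHom ℤ_[p]) : ℤ_[p][X]) : PowerSeries ℤ_[p]) * q))
    {Ls Lf : IwasawaAlgebra p} (hL : IsSprungPair f p ap Ls Lf) (hLμ : Lf ∉ augIdealP p) : IsUnit d := by
  haveI : (augIdealP p).IsPrime := isPrime_augIdealP_holds p
  obtain ⟨i, hi⟩ := (forall_heightOne_C_mem_iff A).1 hcop2
  have h := (C_mul_coleman_eq_mul_of_family hg hap L J hJ x A hd hcop hcop2 f hE3 hL i).1
  refine isUnit_of_C_mul_eq_of_not_mem_augIdealP h ?_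
  rw [(isPrime_augIdealP_holds p).mul_mem_iff_mem_or_mem, not_or]
  exact ⟨hi, hLμ⟩

/-- ★ **`A_δ ∉ (p) ⟺ Col♭(L x_δ) ∉ (p)` when `μ(L♭) = 0`**: by the family ERL `C d · Col♭(L x_δ) = A_δ · L♭` with `d` a unit
(`isUnit_of_family`) and `(p)` prime.  So the displayed `h2` of the F3 assembly says exactly «some class of the family has ♭-Coleman
image NOT divisible by `p`» — the ♭-primitivity of Kato's zeta line at the prime `(p)`, independent of the normalisation of `(A_δ, d)`.
[cite: Kato2004Asterisque, Thm. 12.5 (4), Thm. 12.6 (p. 222), §13.12–13.14 (pp. 231–234)] [cite: Sprung2012, Def. 7.1, Thm. 7.14] -/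
theorem coleman_flat_not_mem_iff_of_family {g : Field.absoluteGaloisGroup E}
    (hg : κ.IsTopGenerator (resGalOfEmb ι' g)) {ap : ℤ} (hap : (p : ℤ) ∣ ap) {c : ℕ → localPoints W E}
    {H : Type*} [AddCommGroup H] [Module (IwasawaAlgebra p) H]
    (L : letI := moduleOfGenerator κ ι' W hg; H →ₗ[IwasawaAlgebra p] (localTowerPointsOfEmb κ ι' W →+ ℤ_[p]))
    (J : letI := moduleOfGenerator κ ι' W hg
      (localTowerPointsOfEmb κ ι' W →+ ℤ_[p]) →ₗ[IwasawaAlgebra p] IwasawaAlgebra p × IwasawaAlgebra p)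
    (hJ : ∀ w, IsColemanPair κ ι' W ap g c w (J w).1 (J w).2)
    {ι : Type*} (x : ι → H) (A : ι → IwasawaAlgebra p) {d : ℤ_[p]} (hd : d ≠ 0)
    (hcop : ∀ 𝔭 : PrimeSpectrum (IwasawaAlgebra p), 𝔭.asIdeal.height = 1 →
      PowerSeries.C (p : ℤ_[p]) ∉ 𝔭.asIdeal → ∃ i, A i ∉ 𝔭.asIdeal)
    (hcop2 : ∀ 𝔭 : PrimeSpectrum (IwasawaAlgebra p), 𝔭.asIdeal.height = 1 →
      PowerSeries.C (p : ℤ_[p]) ∈ 𝔭.asIdeal → ∃ i, A i ∉ 𝔭.asIdeal)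
    {N : ℕ} (f : CuspForm (Gamma0 N) 2)
    (hE3 : ∀ (i : ι) (n : ℕ), ∃ (m : ℕ) (q : IwasawaAlgebra p), PowerSeries.C ((p : ℚ_[p]) ^ m) *
        (iwasawaToPowerSeries p (A i) * (((mazurTateElement f p n).map (algebraMap ℚ ℚ_[p]) : ℚ_[p][X]) : PowerSeries ℚ_[p]) -
          iwasawaToPowerSeries p (PowerSeries.C d * pairingSum W (localTowerPointsOfEmb κ ι' W) g n (c n) (L (x i)))) =
      iwasawaToPowerSeries p ((((cyclotomicOmega p n).map (Int.castRingHom ℤ_[p]) : ℤ_[p][X]) : PowerSeries ℤ_[p]) * q))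
    {Ls Lf : IwasawaAlgebra p} (hL : IsSprungPair f p ap Ls Lf) (hLμ : Lf ∉ augIdealP p) (i : ι) :
    (J (L (x i))).2 ∉ augIdealP p ↔ A i ∉ augIdealP p := by
  haveI : (augIdealP p).IsPrime := isPrime_augIdealP_holds p
  have h := (C_mul_coleman_eq_mul_of_family hg hap L J hJ x A hd hcop hcop2 f hE3 hL i).1
  have hdU := isUnit_of_family hg hap L J hJ x A hd hcop hcop2 f hE3 hL hLμ
  -- `C d` is a unit of `Λ`, so `Col♭ ∈ (p) ⟺ C d · Col♭ ∈ (p) ⟺ A_δ · L♭ ∈ (p) ⟺ A_δ ∈ (p)`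
  have hCU : IsUnit (PowerSeries.C d : IwasawaAlgebra p) := hdU.map PowerSeries.C
  rw [not_iff_not]
  constructor
  · intro hmem
    have h' : A i * Lf ∈ augIdealP p := h ▸ Ideal.mul_mem_left _ _ hmem
    exact ((Ideal.IsPrime.mul_mem_iff_mem_or_mem inferInstance).mp h').resolve_right hLμ
  · intro hA
    have h' : PowerSeries.C d * (J (L (x i))).2 ∈ augIdealP p := h ▸ Ideal.mul_mem_right _ _ hA
    exact (Ideal.unit_mul_mem_iff_mem _ hCU).mp h'

/-- **`h2` ⟹ some class of the family is ♭-PRIMITIVE** (`Col♭(L x_δ) ∉ (p)`), when `μ(L♭) = 0`.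
[cite: Kato2004Asterisque, Thm. 12.5 (4) (p. 222), §13.14 (p. 234)] -/
theorem exists_coleman_flat_not_mem_of_family {g : Field.absoluteGaloisGroup E}
    (hg : κ.IsTopGenerator (resGalOfEmb ι' g)) {ap : ℤ} (hap : (p : ℤ) ∣ ap) {c : ℕ → localPoints W E}
    {H : Type*} [AddCommGroup H] [Module (IwasawaAlgebra p) H]
    (L : letI := moduleOfGenerator κ ι' W hg; H →ₗ[IwasawaAlgebra p] (localTowerPointsOfEmb κ ι' W →+ ℤ_[p]))
    (J : letI := moduleOfGenerator κ ι' W hg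
      (localTowerPointsOfEmb κ ι' W →+ ℤ_[p]) →ₗ[IwasawaAlgebra p] IwasawaAlgebra p × IwasawaAlgebra p)
    (hJ : ∀ w, IsColemanPair κ ι' W ap g c w (J w).1 (J w).2)
    {ι : Type*} (x : ι → H) (A : ι → IwasawaAlgebra p) {d : ℤ_[p]} (hd : d ≠ 0)
    (hcop : ∀ 𝔭 : PrimeSpectrum (IwasawaAlgebra p), 𝔭.asIdeal.height = 1 →
      PowerSeries.C (p : ℤ_[p]) ∉ 𝔭.asIdeal → ∃ i, A i ∉ 𝔭.asIdeal)
    (hcop2 : ∀ 𝔭 : PrimeSpectrum (IwasawaAlgebra p), 𝔭.asIdeal.height = 1 →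
      PowerSeries.C (p : ℤ_[p]) ∈ 𝔭.asIdeal → ∃ i, A i ∉ 𝔭.asIdeal)
    {N : ℕ} (f : CuspForm (Gamma0 N) 2)
    (hE3 : ∀ (i : ι) (n : ℕ), ∃ (m : ℕ) (q : IwasawaAlgebra p), PowerSeries.C ((p : ℚ_[p]) ^ m) *
        (iwasawaToPowerSeries p (A i) * (((mazurTateElement f p n).map (algebraMap ℚ ℚ_[p]) : ℚ_[p][X]) : PowerSeries ℚ_[p]) -
          iwasawaToPowerSeries p (PowerSeries.C d * pairingSum W (localTowerPointsOfEmb κ ι' W) g n (c n) (L (x i)))) =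
      iwasawaToPowerSeries p ((((cyclotomicOmega p n).map (Int.castRingHom ℤ_[p]) : ℤ_[p][X]) : PowerSeries ℤ_[p]) * q))
    {Ls Lf : IwasawaAlgebra p} (hL : IsSprungPair f p ap Ls Lf) (hLμ : Lf ∉ augIdealP p) :
    ∃ i, (J (L (x i))).2 ∉ augIdealP p := by
  obtain ⟨i, hi⟩ := (forall_heightOne_C_mem_iff A).1 hcop2
  exact ⟨i, (coleman_flat_not_mem_iff_of_family hg hap L J hJ x A hd hcop hcop2 f hE3 hL hLμ i).2 hi⟩

end Family

end SSFlatERL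

end Summit.BirchSwinnertonDyer.BirchSwinnertonDyer.Theorems

end
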